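import Summits.NavierStokesRegularity.NavierStokesRegularity.Theorems.FilamentSkeletonRssCoreLinearInvertibilityRadialDivSourceToolsA
import Summits.NavierStokesRegularity.NavierStokesRegularity.Theorems.FilamentSkeletonRssCoreLinearInvertibilityRadialDivSourceToolsB
import Summits.NavierStokesRegularity.NavierStokesRegularity.Theorems.FilamentSkeletonRssCoreLinearInvertibilityArnoldModeOne1DNeutral

/-!
# Even sector of crux `CoreLinearInvertibility` (stmt-NavierStokesRegularity-17973), line `Sketch`:
# the radial block with a divergence-form source — part C, the one-variable bound

THE ONE-VARIABLE RADIAL BOUND WITH A DIVERGENCE-FORM SOURCE. Let `0 < β ≤ 1`, `λ ∈ ℝ`, `b ≥ 4`,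
`W ∈ C¹` (`W′ = W₁` continuous) a compactly supported (`W(b) = W₁(b) = 0`) MASS-ZERO profile
(`∫₀ᵇ W r = 0`), `a ∈ C¹` with `a(b) = 0`, `F` continuous, and suppose the flux `J = rW₁ + (r²/2)W`
satisfies the radial equation with the COUPLING SOURCE of the even sector,

  `J′ = r (F − λ·¼(r a′ + 2a))`      (i.e. `L w₀ = f₀ − λ(4r)⁻¹(r²a)′` in the plane).

Then `∫₀ᵇ e^{βr²/4} W² r ≤ 3C_β ∫₀ᵇ e^{βr²/4} F² r + 3λ²(1/(2−β)² + 1/(4β)) ∫₀ᵇ e^{βr²/4} a² r`,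
`C_β = 3·10⁵e¹²/β²`: only the UNWEIGHTED, UNDIFFERENTIATED weighted-`L²` norm of `a` enters.

Proof. The corrector `Z = −(λ/4)e^{−r²/4}∫₀ʳ e^{s²/4} s a − K e^{−r²/4}`, `K = −(λ/4)∫₀ᵇ s a`, has flux
`rZ′ + (r²/2)Z = −(λ/4) r² a` and `Z(0) = K = −∫₀ᵇ (Z′ + (r/2)Z)`; so `W − Z` has flux `J₁` with
`J₁′ = rF`, `J₁(b) = 0`, and satisfies the centre identity — `radial_profile_bound_of_center` (part A)
bounds it by `C_β ∫ e F² r`; the corrector is bounded by the Volterra/Schur bound of part B and by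
Cauchy–Schwarz for `K`.
-/

set_option linter.dupNamespace false

noncomputable section

namespace Summit.NavierStokesRegularity.NavierStokesRegularity.Theorems

open MeasureTheory Filter Topology Set intervalIntegral

/-- `(x − l y − K z)² ≤ 3(x² + l²y² + K²z²)`. [folklore] -/
theorem sq_add_add_le_three (x y z l K : ℝ) :
    (x + -l * y + -K * z) ^ 2 ≤ 3 * x ^ 2 + 3 * l ^ 2 * y ^ 2 + 3 * K ^ 2 * z ^ 2 := by
  nlinarith [sq_nonneg (x + l * y), sq_nonneg (x + K * z), sq_nonneg (l * y - K * z)]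

/-- **The one-variable radial bound with a divergence-form source** (see the module docstring).
[folklore] -/
theorem radial_profile_bound_div {β lam : ℝ} (hβ : 0 < β) (hβ1 : β ≤ 1)
    {b : ℝ} (hb : 4 ≤ b) {W W₁ F a a₁ : ℝ → ℝ}
    (hW : ∀ r, HasDerivAt W (W₁ r) r) (hW₁c : Continuous W₁) (hFc : Continuous F)
    (ha : ∀ r, HasDerivAt a (a₁ r) r)
    (hflux : ∀ r ∈ Icc 0 b, HasDerivAt (fun s => s * W₁ s + s ^ 2 / 2 * W s)
        (r * (F r - lam * (1 / 4 * (r * a₁ r + 2 * a r)))) r)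
    (hWb : W b = 0) (hW₁b : W₁ b = 0) (hab : a b = 0) (hmass : ∫ r in 0..b, W r * r = 0) :
    ∫ r in 0..b, Real.exp (β / 4 * r ^ 2) * W r ^ 2 * r ≤
      3 * (300000 * Real.exp 12 / β ^ 2) * (∫ r in 0..b, Real.exp (β / 4 * r ^ 2) * F r ^ 2 * r) +
        (3 * lam ^ 2 / (2 - β) ^ 2 + 3 * lam ^ 2 / (4 * β)) *
          ∫ r in 0..b, Real.exp (β / 4 * r ^ 2) * a r ^ 2 * r := by
  have hb0 : (0 : ℝ) ≤ b := by linarith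
  have hWc : Continuous W := continuous_iff_continuousAt.2 fun r => (hW r).continuousAt
  have hac : Continuous a := continuous_iff_continuousAt.2 fun r => (ha r).continuousAt
  have hEc : Continuous fun r : ℝ => Real.exp (β / 4 * r ^ 2) := by fun_prop
  have hGc : Continuous fun r : ℝ => Real.exp (-(r ^ 2 / 4)) := by fun_prop
  set NF : ℝ := ∫ r in 0..b, Real.exp (β / 4 * r ^ 2) * F r ^ 2 * r with hNF
  set A : ℝ := ∫ r in 0..b, Real.exp (β / 4 * r ^ 2) * a r ^ 2 * r with hAdef
  have hNF0 : 0 ≤ NF := intervalIntegral.integral_nonneg hb0 fun r hr =>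
    mul_nonneg (mul_nonneg (Real.exp_pos _).le (sq_nonneg _)) hr.1
  have hA0 : 0 ≤ A := intervalIntegral.integral_nonneg hb0 fun r hr =>
    mul_nonneg (mul_nonneg (Real.exp_pos _).le (sq_nonneg _)) hr.1
  -- the corrector `Z` and its derivative
  set P : ℝ → ℝ := fun r => ∫ s in 0..r, Real.exp (s ^ 2 / 4) * (s * a s) with hP
  set K : ℝ := -(lam / 4) * ∫ s in 0..b, s * a s with hK
  set Z : ℝ → ℝ := fun r => -(lam / 4) * (Real.exp (-(r ^ 2 / 4)) * P r) - K * Real.exp (-(r ^ 2 / 4)) with hZ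
  set Z₁ : ℝ → ℝ := fun r => -(r / 2) * Z r - lam / 4 * (r * a r) with hZ₁
  have hPic : Continuous fun s => Real.exp (s ^ 2 / 4) * (s * a s) := by fun_prop
  have hP' : ∀ r, HasDerivAt P (Real.exp (r ^ 2 / 4) * (r * a r)) r := fun r =>
    intervalIntegral.integral_hasDerivAt_right (hPic.intervalIntegrable _ _)
      (hPic.stronglyMeasurableAtFilter _ _) hPic.continuousAt
  have hPc : Continuous P := continuous_iff_continuousAt.2 fun r => (hP' r).continuousAt
  have hP0 : P 0 = 0 := by simp [hP]
  have hZ' : ∀ r, HasDerivAt Z (Z₁ r) r := by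
    intro r
    have h1 := ((am1_hasDerivAt_gauss r).mul (hP' r)).const_mul (-(lam / 4))
    have h2 := (am1_hasDerivAt_gauss r).const_mul K
    have h := h1.sub h2
    refine h.congr_deriv ?_
    have he : Real.exp (-(r ^ 2 / 4)) * Real.exp (r ^ 2 / 4) = 1 := by
      rw [← Real.exp_add, neg_add_cancel, Real.exp_zero]
    simp only [hZ₁, hZ]
    linear_combination (-(lam / 4) * (r * a r)) * he
  have hZc : Continuous Z := continuous_iff_continuousAt.2 fun r => (hZ' r).continuousAt
  have hZ₁c : Continuous Z₁ := by
    simp only [hZ₁]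
    exact ((continuous_id.div_const 2).neg.mul hZc).sub (continuous_const.mul (continuous_id.mul hac))
  have hZ0 : Z 0 = -K := by simp [hZ, hP0]
  -- the corrected profile `W♯ = W − Z`
  set Ws : ℝ → ℝ := fun r => W r - Z r with hWs
  set Ws₁ : ℝ → ℝ := fun r => W₁ r - Z₁ r with hWs₁
  have hWs' : ∀ r, HasDerivAt Ws (Ws₁ r) r := fun r => (hW r).sub (hZ' r)
  have hWs₁c : Continuous Ws₁ := hW₁c.sub hZ₁c
  set Js : ℝ → ℝ := fun r => r * Ws₁ r + r ^ 2 / 2 * Ws r with hJs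
  have hJs_eq : ∀ r, Js r = (r * W₁ r + r ^ 2 / 2 * W r) + lam / 4 * (r ^ 2 * a r) := by
    intro r; simp only [hJs, hWs, hWs₁, hZ₁]; ring
  have hJs' : ∀ r ∈ Icc 0 b, HasDerivAt Js (r * F r) r := by
    intro r hr
    have h2 : HasDerivAt (fun s => lam / 4 * (s ^ 2 * a s)) (lam / 4 * (2 * r * a r + r ^ 2 * a₁ r)) r := by
      refine (((hasDerivAt_pow 2 r).fun_mul (ha r)).const_mul (lam / 4)).congr_deriv ?_
      push_cast
      ring
    have h := (hflux r hr).fun_add h2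
    rw [show Js = fun s => (s * W₁ s + s ^ 2 / 2 * W s) + lam / 4 * (s ^ 2 * a s) from funext hJs_eq]
    refine h.congr_deriv ?_
    ring
  have hJsb : Js b = 0 := by rw [hJs_eq, hWb, hW₁b, hab]; ring
  -- the centre identity for `W♯`
  have hW0 : W 0 = -∫ r in 0..b, (W₁ r + r / 2 * W r) := by
    have h1 : ∫ r in 0..b, W₁ r = W b - W 0 :=
      integral_eq_sub_of_hasDerivAt (fun r _ => hW r) (hW₁c.intervalIntegrable _ _)
    have hi1 : IntervalIntegrable W₁ volume 0 b := hW₁c.intervalIntegrable _ _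
    have hi2 : IntervalIntegrable (fun r => r / 2 * W r) volume 0 b :=
      ((continuous_id.div_const 2).mul hWc).intervalIntegrable _ _
    have h3 : ∫ r in 0..b, r / 2 * W r = 1 / 2 * ∫ r in 0..b, W r * r := by
      rw [← intervalIntegral.integral_const_mul]
      exact intervalIntegral.integral_congr fun r _ => by ring
    rw [intervalIntegral.integral_add hi1 hi2, h1, h3, hmass, hWb]
    ring
  have hZint : ∫ r in 0..b, (Z₁ r + r / 2 * Z r) = K := by
    have e : (fun r => Z₁ r + r / 2 * Z r) = fun r => -(lam / 4) * (r * a r) := by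
      funext r; simp only [hZ₁]; ring
    rw [e, intervalIntegral.integral_const_mul]
  have h0s : Ws 0 = -∫ r in 0..b, (Ws₁ r + r / 2 * Ws r) := by
    have e : (fun r => Ws₁ r + r / 2 * Ws r) = fun r => (W₁ r + r / 2 * W r) - (Z₁ r + r / 2 * Z r) := by
      funext r; simp only [hWs, hWs₁]; ring
    have hi1 : IntervalIntegrable (fun r => W₁ r + r / 2 * W r) volume 0 b :=
      (hW₁c.add ((continuous_id.div_const 2).mul hWc)).intervalIntegrable _ _
    have hi2 : IntervalIntegrable (fun r => Z₁ r + r / 2 * Z r) volume 0 b :=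
      (hZ₁c.add ((continuous_id.div_const 2).mul hZc)).intervalIntegrable _ _
    rw [e, intervalIntegral.integral_sub hi1 hi2, hZint]
    simp only [hWs]
    rw [hZ0, hW0]
    ring
  -- the radial bound for `W♯`
  have hmain := radial_profile_bound_of_center hβ hβ1 hb hWs' hWs₁c hFc (J := Js) (fun r => rfl) hJs' hJsb h0s
  have hWs_le : ∫ r in 0..b, Real.exp (β / 4 * r ^ 2) * Ws r ^ 2 * r ≤ 300000 * Real.exp 12 / β ^ 2 * NF := by
    refine le_trans ?_ hmain
    have hWsc : Continuous Ws := hWc.sub hZc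
    have hIa : IntervalIntegrable (fun r => Real.exp (β / 4 * r ^ 2) * Ws r ^ 2 * r) volume 0 b := by
      apply Continuous.intervalIntegrable; fun_prop
    have hIb : IntervalIntegrable (fun r => Real.exp (β / 4 * r ^ 2) * ((1 + r ^ 2) * Ws r ^ 2 + r ^ 2 * Ws₁ r ^ 2) * r)
        volume 0 b := by
      apply Continuous.intervalIntegrable; fun_prop
    refine intervalIntegral.integral_mono_on hb0 hIa hIb fun r hr => ?_
    have h0 : 0 ≤ Real.exp (β / 4 * r ^ 2) * r := mul_nonneg (Real.exp_pos _).le hr.1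
    have h1 : Ws r ^ 2 ≤ (1 + r ^ 2) * Ws r ^ 2 + r ^ 2 * Ws₁ r ^ 2 := by
      have e : (1 + r ^ 2) * Ws r ^ 2 + r ^ 2 * Ws₁ r ^ 2 = Ws r ^ 2 + (r ^ 2 * Ws r ^ 2 + r ^ 2 * Ws₁ r ^ 2) := by ring
      rw [e]
      exact le_add_of_nonneg_right (by positivity)
    calc Real.exp (β / 4 * r ^ 2) * Ws r ^ 2 * r = Real.exp (β / 4 * r ^ 2) * r * Ws r ^ 2 := by ring
      _ ≤ Real.exp (β / 4 * r ^ 2) * r * ((1 + r ^ 2) * Ws r ^ 2 + r ^ 2 * Ws₁ r ^ 2) :=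
          mul_le_mul_of_nonneg_left h1 h0
      _ = _ := by ring
  -- the corrector pieces
  have hV : ∫ r in 0..b, Real.exp (β / 4 * r ^ 2) * (Real.exp (-(r ^ 2 / 4)) * P r) ^ 2 * r ≤
      16 / (2 - β) ^ 2 * A := radial_volterra_sq_le hβ1 hb0 hac
  have hKsq : K ^ 2 ≤ lam ^ 2 / (8 * β) * A := by
    -- `(∫ s a)² ≤ (∫ e^{−βs²/4} s)(∫ e^{βs²/4} a² s) ≤ (2/β) A`
    have hcs := sq_intervalIntegral_mul_le hb0 (f := fun s => Real.exp (-(β / 8) * s ^ 2) * Real.sqrt s)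
      (g := fun s => Real.exp (β / 8 * s ^ 2) * (Real.sqrt s * a s))
      ((by fun_prop : Continuous fun s => (Real.exp (-(β / 8) * s ^ 2) * Real.sqrt s) ^ 2).intervalIntegrable _ _)
      ((by fun_prop : Continuous fun s => (Real.exp (β / 8 * s ^ 2) * (Real.sqrt s * a s)) ^ 2).intervalIntegrable _ _)
      ((by fun_prop : Continuous fun s => Real.exp (-(β / 8) * s ^ 2) * Real.sqrt s *
        (Real.exp (β / 8 * s ^ 2) * (Real.sqrt s * a s))).intervalIntegrable _ _)
    have e1 : ∫ s in 0..b, Real.exp (-(β / 8) * s ^ 2) * Real.sqrt s * (Real.exp (β / 8 * s ^ 2) * (Real.sqrt s * a s)) =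
        ∫ s in 0..b, s * a s := by
      refine intervalIntegral.integral_congr fun s hs => ?_
      rw [uIcc_of_le hb0] at hs
      have hss : Real.sqrt s * Real.sqrt s = s := Real.mul_self_sqrt hs.1
      have he : Real.exp (-(β / 8) * s ^ 2) * Real.exp (β / 8 * s ^ 2) = 1 := by
        rw [← Real.exp_add]; simp [neg_mul]
      calc Real.exp (-(β / 8) * s ^ 2) * Real.sqrt s * (Real.exp (β / 8 * s ^ 2) * (Real.sqrt s * a s))
          = (Real.exp (-(β / 8) * s ^ 2) * Real.exp (β / 8 * s ^ 2)) * (Real.sqrt s * Real.sqrt s) * a s := by ring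
        _ = s * a s := by rw [he, hss, one_mul]
    have e2 : ∫ s in 0..b, (Real.exp (-(β / 8) * s ^ 2) * Real.sqrt s) ^ 2 ≤ 2 / β := by
      have h1 : ∫ s in 0..b, (Real.exp (-(β / 8) * s ^ 2) * Real.sqrt s) ^ 2 = ∫ s in 0..b, s * Real.exp (-(β / 4) * s ^ 2) := by
        refine intervalIntegral.integral_congr fun s hs => ?_
        rw [uIcc_of_le hb0] at hs
        have hss : Real.sqrt s ^ 2 = s := Real.sq_sqrt hs.1
        have he : Real.exp (-(β / 8) * s ^ 2) ^ 2 = Real.exp (-(β / 4) * s ^ 2) := by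
          rw [← Real.exp_nat_mul]; congr 1; push_cast; ring
        show (Real.exp (-(β / 8) * s ^ 2) * Real.sqrt s) ^ 2 = s * Real.exp (-(β / 4) * s ^ 2)
        rw [mul_pow, he, hss]; ring
      rw [h1, intervalIntegral_mul_exp_mul_sq (by linarith : -(β / 4) ≠ 0) b]
      have hle : (Real.exp (-(β / 4) * b ^ 2) - 1) / (2 * -(β / 4)) ≤ 1 / (2 * (β / 4)) := by
        rw [show (2 : ℝ) * -(β / 4) = -(2 * (β / 4)) by ring, div_neg, ← neg_div]
        refine div_le_div_of_nonneg_right ?_ (by positivity)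
        have : 0 < Real.exp (-(β / 4) * b ^ 2) := Real.exp_pos _
        linarith
      refine hle.trans_eq ?_
      field_simp
      norm_num
    have e3 : ∫ s in 0..b, (Real.exp (β / 8 * s ^ 2) * (Real.sqrt s * a s)) ^ 2 = A := by
      refine intervalIntegral.integral_congr fun s hs => ?_
      rw [uIcc_of_le hb0] at hs
      have hss : Real.sqrt s ^ 2 = s := Real.sq_sqrt hs.1
      have he : Real.exp (β / 8 * s ^ 2) ^ 2 = Real.exp (β / 4 * s ^ 2) := by
        rw [← Real.exp_nat_mul]; congr 1; push_cast; ring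
      show (Real.exp (β / 8 * s ^ 2) * (Real.sqrt s * a s)) ^ 2 = Real.exp (β / 4 * s ^ 2) * a s ^ 2 * s
      rw [mul_pow, mul_pow, he, hss]; ring
    rw [e1, e3] at hcs
    have hI2 : (∫ s in 0..b, s * a s) ^ 2 ≤ 2 / β * A :=
      hcs.trans (mul_le_mul_of_nonneg_right e2 hA0)
    have hK2 : K ^ 2 = (lam / 4) ^ 2 * (∫ s in 0..b, s * a s) ^ 2 := by rw [hK]; ring
    rw [hK2]
    calc (lam / 4) ^ 2 * (∫ s in 0..b, s * a s) ^ 2 ≤ (lam / 4) ^ 2 * (2 / β * A) :=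
          mul_le_mul_of_nonneg_left hI2 (sq_nonneg _)
      _ = lam ^ 2 / (8 * β) * A := by field_simp; ring
  have hG : ∫ r in 0..b, Real.exp (β / 4 * r ^ 2) * Real.exp (-(r ^ 2 / 4)) ^ 2 * r ≤ 2 := by
    have h1 : ∫ r in 0..b, Real.exp (β / 4 * r ^ 2) * Real.exp (-(r ^ 2 / 4)) ^ 2 * r ≤
        ∫ r in 0..b, r * Real.exp (-(1 / 4) * r ^ 2) := by
      refine intervalIntegral.integral_mono_on hb0 (((hEc.mul (hGc.pow 2)).mul continuous_id).intervalIntegrable _ _)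
        ((by fun_prop : Continuous fun r => r * Real.exp (-(1 / 4) * r ^ 2)).intervalIntegrable _ _) fun r hr => ?_
      have he : Real.exp (β / 4 * r ^ 2) * Real.exp (-(r ^ 2 / 4)) ^ 2 = Real.exp ((β / 4 - 1 / 2) * r ^ 2) := by
        rw [← Real.exp_nat_mul, ← Real.exp_add]; congr 1; push_cast; ring
      have hle : Real.exp ((β / 4 - 1 / 2) * r ^ 2) ≤ Real.exp (-(1 / 4) * r ^ 2) :=
        Real.exp_le_exp.2 (mul_le_mul_of_nonneg_right (by linarith) (sq_nonneg r))
      rw [he]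
      exact (mul_le_mul_of_nonneg_right hle hr.1).trans_eq (mul_comm _ _)
    refine h1.trans ?_
    rw [intervalIntegral_mul_exp_mul_sq (by norm_num : -(1 / 4 : ℝ) ≠ 0) b]
    have hpos : 0 < Real.exp (-(1 / 4) * b ^ 2) := Real.exp_pos _
    have e : (Real.exp (-(1 / 4) * b ^ 2) - 1) / (2 * -(1 / 4)) = 2 * (1 - Real.exp (-(1 / 4) * b ^ 2)) := by
      field_simp; ring
    rw [e]
    linarith [hpos]
  -- `W = W♯ + Z`: pointwise `(x + y + z)² ≤ 3(x² + y² + z²)` and integrate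
  have hsplit : ∀ r, W r = Ws r + (-(lam / 4) * (Real.exp (-(r ^ 2 / 4)) * P r)) + (-K * Real.exp (-(r ^ 2 / 4))) := by
    intro r; simp only [hWs, hZ]; ring
  have hIW : IntervalIntegrable (fun r => Real.exp (β / 4 * r ^ 2) * W r ^ 2 * r) volume 0 b :=
    ((hEc.mul (hWc.pow 2)).mul continuous_id).intervalIntegrable _ _
  have hWsc : Continuous Ws := hWc.sub hZc
  have hI1 : IntervalIntegrable (fun r => Real.exp (β / 4 * r ^ 2) * Ws r ^ 2 * r) volume 0 b :=
    ((hEc.mul (hWsc.pow 2)).mul continuous_id).intervalIntegrable _ _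
  have hI2 : IntervalIntegrable (fun r => Real.exp (β / 4 * r ^ 2) * (Real.exp (-(r ^ 2 / 4)) * P r) ^ 2 * r) volume 0 b :=
    ((hEc.mul ((hGc.mul hPc).pow 2)).mul continuous_id).intervalIntegrable _ _
  have hI3 : IntervalIntegrable (fun r => Real.exp (β / 4 * r ^ 2) * Real.exp (-(r ^ 2 / 4)) ^ 2 * r) volume 0 b :=
    ((hEc.mul (hGc.pow 2)).mul continuous_id).intervalIntegrable _ _
  have hmono : ∫ r in 0..b, Real.exp (β / 4 * r ^ 2) * W r ^ 2 * r ≤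
      ∫ r in 0..b, (3 * (Real.exp (β / 4 * r ^ 2) * Ws r ^ 2 * r) +
        3 * (lam / 4) ^ 2 * (Real.exp (β / 4 * r ^ 2) * (Real.exp (-(r ^ 2 / 4)) * P r) ^ 2 * r) +
        3 * K ^ 2 * (Real.exp (β / 4 * r ^ 2) * Real.exp (-(r ^ 2 / 4)) ^ 2 * r)) := by
    refine intervalIntegral.integral_mono_on hb0 hIW
      (((hI1.const_mul 3).add (hI2.const_mul _)).add (hI3.const_mul _)) fun r hr => ?_
    have h0 : 0 ≤ Real.exp (β / 4 * r ^ 2) * r := mul_nonneg (Real.exp_pos _).le hr.1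
    have h1 : W r ^ 2 ≤ 3 * Ws r ^ 2 + 3 * (lam / 4) ^ 2 * (Real.exp (-(r ^ 2 / 4)) * P r) ^ 2 +
        3 * K ^ 2 * Real.exp (-(r ^ 2 / 4)) ^ 2 := by
      rw [hsplit r]
      exact sq_add_add_le_three _ _ _ (lam / 4) K
    have h2 := mul_le_mul_of_nonneg_left h1 h0
    calc Real.exp (β / 4 * r ^ 2) * W r ^ 2 * r = Real.exp (β / 4 * r ^ 2) * r * W r ^ 2 := by ring
      _ ≤ Real.exp (β / 4 * r ^ 2) * r * (3 * Ws r ^ 2 + 3 * (lam / 4) ^ 2 * (Real.exp (-(r ^ 2 / 4)) * P r) ^ 2 +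
          3 * K ^ 2 * Real.exp (-(r ^ 2 / 4)) ^ 2) := h2
      _ = _ := by ring
  rw [intervalIntegral.integral_add ((hI1.const_mul 3).add (hI2.const_mul _)) (hI3.const_mul _),
    intervalIntegral.integral_add (hI1.const_mul 3) (hI2.const_mul _),
    intervalIntegral.integral_const_mul, intervalIntegral.integral_const_mul,
    intervalIntegral.integral_const_mul] at hmono
  -- bookkeeping
  have hK3 : 3 * K ^ 2 * (∫ r in 0..b, Real.exp (β / 4 * r ^ 2) * Real.exp (-(r ^ 2 / 4)) ^ 2 * r) ≤
      3 * (lam ^ 2 / (8 * β) * A) * 2 := by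
    have hG0 : 0 ≤ ∫ r in 0..b, Real.exp (β / 4 * r ^ 2) * Real.exp (-(r ^ 2 / 4)) ^ 2 * r :=
      intervalIntegral.integral_nonneg hb0 fun r hr => mul_nonneg (mul_nonneg (Real.exp_pos _).le (sq_nonneg _)) hr.1
    calc 3 * K ^ 2 * (∫ r in 0..b, Real.exp (β / 4 * r ^ 2) * Real.exp (-(r ^ 2 / 4)) ^ 2 * r)
        ≤ 3 * K ^ 2 * 2 := mul_le_mul_of_nonneg_left hG (by positivity)
      _ ≤ 3 * (lam ^ 2 / (8 * β) * A) * 2 := by linarith [hKsq]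
  have hV3 : 3 * (lam / 4) ^ 2 * (∫ r in 0..b, Real.exp (β / 4 * r ^ 2) * (Real.exp (-(r ^ 2 / 4)) * P r) ^ 2 * r) ≤
      3 * (lam / 4) ^ 2 * (16 / (2 - β) ^ 2 * A) := mul_le_mul_of_nonneg_left hV (by positivity)
  have h2β : 0 < 2 - β := by linarith
  have e : 3 * (300000 * Real.exp 12 / β ^ 2) * NF + (3 * lam ^ 2 / (2 - β) ^ 2 + 3 * lam ^ 2 / (4 * β)) * A =
      3 * (300000 * Real.exp 12 / β ^ 2 * NF) + 3 * (lam / 4) ^ 2 * (16 / (2 - β) ^ 2 * A) +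
        3 * (lam ^ 2 / (8 * β) * A) * 2 := by
    field_simp
    ring
  rw [e]
  linarith [hmono, hWs_le, hV3, hK3]

end Summit.NavierStokesRegularity.NavierStokesRegularity.Theorems
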